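import Literature.MathematicalPhysics.QuantumFieldTheory.Balaban1983to89.B6IndexCorrV1L0
import Literature.MathematicalPhysics.QuantumFieldTheory.Balaban1983to89.B6Geom246MultiLevelTorusL0
import Literature.MathematicalPhysics.QuantumFieldTheory.Balaban1983to89.B6GlobalChartV1L0
import Literature.MathematicalPhysics.QuantumFieldTheory.Balaban1983to89.B6MultiLevelTorusOperatorL0
import Literature.MathematicalPhysics.QuantumFieldTheory.Balaban1983to89.B6MemberOfCubeV1
/-!
# `Balaban1983to89.B6MemberOfCubeV1L0` — LEVEL-0 TWIN (programme G-F3′-L0, director-ym LINE №27 / UV3-NODE §24.5; plan `lit-balaban-r03/G-F3L0-PLAN.md`) of `B6MemberOfCubeV1`: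
the same declarations, SAME NAMES AND STATEMENTS, for nested families WITH print's region `Λ₀ = T ∖ Ω₁` ADMITTED (structures
`B6MultiLevelBoxOperatorL0.Domains` / `B6MultiLevelTorusOperatorL0.TDomains`: levels `0, …, k`, the level-`0` block a single site, `Q′₀ = id`,
finite weight `a₀` — print p.225 (2.14) «Σ_{j=0}^k … (Q′₀λ)(x) = λ(x), x ∈ Λ₀», p.229 «taking a sequence (2.1) … smallest possible domains B^j(Λ_j),
and considering the operator Δ_a defined by (2.19), (2.20) for this sequence»).  Every `D`-free object is the lineage's, consumed BY NAME; no existing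
module is touched; no fact is minted.  Unit `lit-balaban-r03` (B6 fold owner, r03 gen 36); referee ref-4.  THE TWIN'S DOCUMENTATION FOLLOWS
VERBATIM (its «levels 1 … k» / «Ω₁ = X» sentences describe the twin; here `j` runs from `0` and `Ω₁` may be a proper subset).

# `Balaban1983to89.B6MemberOfCubeV1` — T. Bałaban, *Propagators and renormalization transformations for lattice gauge theories. II*, Commun.
# Math. Phys. **96** (1984) 223–250 [Balaban1984PropagatorsII], p. 238–239, (2.89)–(2.91): THE MEMBER `(T_□, Λ′(□), w_□)` OF A CUBE `□`
# OF THE `L^{−j}`-SCALE, CONSTRUCTED FROM THE GLOBAL DATA `(𝔅, w)`, AND ITS RING HYPOTHESIS `hagree` FROM GEOMETRY ONLY — `Λ′(□)` by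
# (2.89) and `w_□` by pull-back are DEFINITIONS here, so the hypotheses `hΛ`, `hWj`, `hWj1` of `B6IndexCorrV1L0.hagree_domT` are PROVED, and
# the separation input `hfar` is DERIVED from (2.2) on the torus (`B6MultiLevelTorusOperatorL0.TDomains.sepT`) (item (d5-b)(i)–(ii) of the B6 fold owner's programme
# for the genuine k-level Proposition 2.6, B6-CLOSURE.md §5 item 12)

statement-level skeleton of published theorems with citation tags; proofs where landed; nothing here is a claim about the Yang–Mills mass gap

PDF held: `paper:balaban1984-cmp96-propagators-rt-ii` (journal page = PDF page + 222); p. 224 [PDF 2] ((2.2): *"dist(Ω_j^c, Ω_{j+1}) > RML^jη"*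
in the lineage's reading `B6MultiLevelTorusOperatorL0.TDomains.sepT`), p. 238–239 [PDF 16–17] (*"Let us take a cube □ connected with a L^{−j}-scale … We identify the
boundary of □̃³ and we get a torus which will be denoted by T_□ … We define B^j(Λ′) = □̃² ∩ B^{j+1}(Λ_{j+1}), (2.89)"*; (2.90) `G_□ = G(B^j(Λ′))`
with the two-scale `Δ_a` of the member).

CITATION HEADER (lean-in-tree rule) — WHAT IS REPRODUCED.  Phase-2 file of the `lit-balaban` typed skeleton (HOME `run/shared/lean/pub/lit-balaban/`),
unit `lit-balaban-r03` (B6 fold owner; r03 gen 19, literature-prover-lit-balaban-r03-g19-0), referee ref-4.  SKELETON rows **B6.Eq2.89** × **B6.Eq2.90**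
× **B6.Eq2.91** × **B6.Eq2.1-2.3 (2.2)** × **B6.Prop2.6** (cells; decls of record untouched).  IMPORTS BY NAME, restating nothing: `B6IndexCorrV1`
(**`hagree_domT`**, `lam…`), `B6AgreeQaQV1Chart` (`eSj`/`eBj`, `eSj_inj`, `iterBlockOf_eS`, `window_of_deep_block`, `deep_block_of_near`, `NearB`,
`wxG`/`wxG_of_lam`), `B6AgreeLapV1Chart` (`DeepS/DeepB`, `cB`, `eS_surj`, `deepS_mono`), `B6GlobalChartV1` (`PV`, `toBox`, `domT`,
`iterBlockOf_mem_domT_iff`), `B6Geom246MultiLevelTorus` (p21: **`dist_toT_toR`** — the torus sup-distance is a metric, `torusSupNorm_neg`),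
`B4TorusKernel.MultiPeriod` (`torusSupNorm`, `circAbs_le_abs`, `circAbs_add_mul`), `B6MultiLevelTorusOperatorL0.TDomains` (**`sepT`** = (2.2)),
`B6Prop25TwoScaleCensus.TSIdx` (the member index: `m, K, j, Λ′, w` with the band `a₀(L^j)^{d+1} ≤ w ≤ a₁(L^j)^{d+1}`), `B6SectCTwoScaleV1.CIdx`.

THIS FILE (0 sorry; standard axioms; NO `def … : Prop`; six small definitions WITH BODIES: `bare`, `LamOf`, `wOf`, `memberOf`, `clampW`, `tOf`).
* §1 `eSj_surj` (the level chart is onto `T^{(k)}_□` from the window `k`-blocks); **`lam_chart_iff_of_image`** (if `Λ′` is the `e_{j+1}`-image of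
  the window `(j+1)`-blocks lying in a set `Om`, then `e_{j+1} Y ∈ Λ′ ↔ Y ∈ Om` on window blocks — injectivity of the chart).
* §2 **`torusSupNorm_lt_of_block_shift`** (adjacent `n`-blocks of `T_η`, wrapping allowed, are at torus sup-distance `< 2L^n`), `torusSupNorm_sub_le`
  (triangle inequality, from p21's `dist_toT_toR`), **`hfar_of_sepT`**: the separation input `hfar` of `hagree_domT` (no `Ω_n`-block adjacent to the
  `n`-block of a deep window site, `j + 2 ≤ n ≤ k`) from `B6MultiLevelTorusOperatorL0.TDomains.sepT (n − 1)`, given a site `x₁` of level `j` with the window (at depth `r`)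
  within torus distance `Δ` of it and `Δ + 2L^n ≤ R·M_h·L^n` (`= R·bigSide ℓ M_h (n−1)`).
* §3 the constructor: `bare` (size and scale only — names the charts), **`LamOf`** (`Λ′(□) := e_{j+1}{window (j+1)-blocks in Om}`), **`wOf`** (weights
  pulled back through the bond charts, default off the window image), **`memberOf`** (a `TSIdx`); `eBj_inj_window`; **`lam_memberOf`** (`hΛ` PROVED),
  **`w_memberOf_inl`**, **`w_memberOf_inr`** (the weight of the chart of a window bond is the prescribed one — PROVED by injectivity of `eBj`).
* §4 `clampW` (+ `clampW_mem`, `clampW_of_mem`), **`tOf`** (the member of a cube for the global data `(domT, w, c′)`: `Om := Ω_{j+1}`, weights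
  `clamp(w̃_j ∘ e⁻¹/(c′/L^j)²)`), **`hagree_tOf`**: `M·h_□ = (c′/L^j)²•(ε(Δ_□ + Q*a_□Q)ρ)·h_□` over `domT` for `t(□) = tOf …` and every `h_□`
  supported at margin `4L^{j+1}`, from: the two-level window `hlev`, the separation input `hfar`, and the band hypothesis `hband` (the global
  weights near `□`, divided by `(c′/L^j)²`, lie in `[a₀, a₁]·(L^j)^{d+1}`) — `hΛ`/`hWj`/`hWj1` discharged by construction.

HONEST SCOPE / DIVERGENCES. (1) `1 ≤ j`, `j + 1 ≤ k` as in `B6IndexCorrV1` (top scale and `Ω₁ = T_η` not treated). (2) The member's size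
`(m_t, K_t)` and the window corner `x₀` are free parameters here: that `□̃³` fits in the lower half-period sub-window with margin (F3 of the
programme, `B6FullWindowReachV1`) and that the window is two-level (`hlev`) are inputs of the assembly, from p21's cover `cubeSetT` — NOT proved
here. (3) `hband` is an hypothesis on the GLOBAL weights `w` of the V1 `Δ_a = deltaAE domT c′ w` (free in the V1 model); print's weights
`a(L^jη)^{−2}` on `Λ_j` satisfy it with `a₀ = a₁·L^{−(d+3)}`-type constants only scale by scale — the clamp keeps `t(□)` a legitimate `TSIdx` in all
cases and the agreement is claimed only under `hband`. (4) `hfar_of_sepT` asks for ONE site of level `j` near the window (print: *"□ connected with a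
L^{−j}-scale"*) and `R·M_h ≥ Δ/L^n + 2`; it is not asserted that every cube of p21's `cubeSetT` satisfies this (the assembly's job).
Value = typed skeleton: the third ring hypothesis of (2.91) for a constructed member, modulo cube geometry; NOT summit progress.
-/

noncomputable section

open scoped BigOperators
open Finset

namespace Literature.MathematicalPhysics.QuantumFieldTheory.Balaban1983to89.B6MemberOfCubeV1L0

open B6Prop25TwoScaleCensus (TSIdx)
open B6GlobalChartV1 (PV toBox)
open B6GlobalChartV1L0 (domT iterBlockOf_mem_domT_iff)
open B6AgreeLapV1Chart
open B6AgreeQaQV1Chart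
open B6IndexCorrV1 hiding hagree_domT kagree_QaQ_domT lamBond_iff_chart_out lamBond_succ_iff_chart_in not_near_of_level_ne
open B6IndexCorrV1L0
open B5Eq118OneStroke (iterBlockOf iterBlock mem_iterBlock val_iterBlockOf iterBlockOf_zero iterBlockOf_succ)
open B6MultiLevelBoxOperator (N0)
open B6MultiLevelTorusOperatorL0 (TDomains)
open Literature.MathematicalPhysics.QuantumFieldTheory.Balaban1983to89.B6MemberOfCubeV1 (eSj_surj lam_chart_iff_of_image one_le_N0 torusSupNorm_lt_of_block_shift torusSupNorm_sub_le eBj_inj_window bare LamOf wOf memberOf memberOf_j memberOf_mK lam_memberOf w_memberOf_inl w_memberOf_inr clampW clampW_mem clampW_of_mem)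

variable {d ℓ : ℕ} {hd : 1 ≤ d + 1} {hL : Odd (ℓ + 1) ∧ 1 < ℓ + 1} {a₀ a₁ : ℝ} {m K : ℕ}
variable {t : TSIdx d (ℓ + 1) hd hL a₀ a₁} {x₀ : Fin (d + 1) → ℤ}

/-! ## §1  Every site of `T^{(k)}_□` is the chart of a window `k`-block; `Λ′(□)` as an image satisfies `hΛ` -/

section Far

open B4TorusKernel.MultiPeriod (torusSupNorm circAbs circAbs_le_abs circAbs_add_mul)
open B6Geom246MultiLevelTorus (toT dist_toT_toR torusSupNorm_neg)
open B6Geom246MultiLevelBox (toR)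
open B6MultiLevelBoxOperator (bigSide)

variable {Mh k R : ℕ} {P' : Fin (d + 1) → ℕ}

/-- labels with equal quotients by `n` differ by less than `n`. [folklore] -/
private theorem sub_lt_of_div_eq {a b n : ℕ} (hn : 0 < n) (h : a / n = b / n) : ((a : ℤ) - b) < n ∧ ((b : ℤ) - a) < n := by
  have h1 := Nat.lt_div_mul_add (a := a) hn
  have h2 := Nat.div_mul_le_self b n
  have h3 := Nat.lt_div_mul_add (a := b) hn
  have h4 := Nat.div_mul_le_self a n
  rw [h] at h1 h4
  constructor <;> omega

/-- consecutive quotients by `n`: the labels differ by a positive amount `< 2n`. [folklore] -/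
private theorem sub_lt_of_div_succ {a b n : ℕ} (hn : 0 < n) (h : b / n = a / n + 1) : (0 : ℤ) < (b : ℤ) - a ∧ ((b : ℤ) - a) < 2 * n := by
  have h1 := Nat.lt_div_mul_add (a := a) hn
  have h2 := Nat.div_mul_le_self b n
  have h3 := Nat.lt_div_mul_add (a := b) hn
  have h4 := Nat.div_mul_le_self a n
  rw [h, Nat.add_mul, one_mul] at h2 h3
  constructor <;> omega

/-- `(y − e_μ) + e_μ = y`. [folklore] -/
private theorem munshift_shift {P : Params} {j : ℕ} (y : Site P j) (μ : Fin P.d) : (y.unshift μ).shift μ = y := by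
  funext ν
  by_cases h : ν = μ
  · subst h; simp [Site.shift, Site.unshift]
  · simp [Site.shift, Site.unshift, Function.update_of_ne h]

/-- **THE SEPARATION INPUT `hfar` FROM (2.2) ON THE TORUS**: if the window of the member (at depth `r`) lies within torus
sup-distance `Δ` of a site `x₁` of level `j`, and `Δ + 2L^n ≤ R·M_h·L^n` for `j + 2 ≤ n ≤ k`, then no `n`-block adjacent (on `T^{(n)}`)
to the `n`-block of a deep window site lies in `Ω_n`: such a block would contain a site of level `≥ n` within `Δ + 2L^n` of `x₁`, against
`dist_T(Ω^c_{n−1}, Ω_n) > R·M_h·L^n` ((2.2), `B6MultiLevelTorusOperatorL0.TDomains.sepT (n − 1)`). [cite: Balaban1984PropagatorsII, (2.2) p.224, p.238 («□ connected with a L^{−j}-scale»)] -/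
theorem hfar_of_sepT (hN : ∀ μ, N0 ℓ Mh k P' μ = (PV d ℓ m K hd hL).sitesPerDir 0) (D : B6MultiLevelTorusOperatorL0.TDomains d ℓ Mh k P' R) (hk : k ≤ m + K)
    {r : ℕ} {Δ : ℝ} (x₁ : Site (PV d ℓ m K hd hL) 0) (hx₁ : D.lev (toBox hN x₁).1 = t.j)
    (hΔ : ∀ x, x ∈ DeepS t x₀ r → torusSupNorm (N0 ℓ Mh k P') ((toBox hN x₁).1 - (toBox hN x).1) ≤ Δ)
    (hR : ∀ n, t.j + 2 ≤ n → n ≤ k → Δ + 2 * (((ℓ + 1 : ℕ) : ℝ)) ^ n ≤ ((R * bigSide ℓ Mh (n - 1) : ℕ) : ℝ)) :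
    ∀ n, t.j + 2 ≤ n → n ≤ k → ∀ x : Site (PV d ℓ m K hd hL) 0, x ∈ DeepS t x₀ r → ∀ μ,
      (iterBlockOf n x).shift μ ∉ (domT hN D hk).Om n ∧ (iterBlockOf n x).unshift μ ∉ (domT hN D hk).Om n := by
  intro n hn hnk x hx μ
  have hnm : n ≤ m + K := le_trans hnk hk
  have hN1 := one_le_N0 hN
  -- the common contradiction: a site `x'` of level `≥ n` torus-close to `x`
  have main : ∀ x' : Site (PV d ℓ m K hd hL) 0, n ≤ D.lev (toBox hN x').1 →
      ¬ torusSupNorm (N0 ℓ Mh k P') ((toBox hN x).1 - (toBox hN x').1) < 2 * (((ℓ + 1 : ℕ) : ℝ)) ^ n := by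
    intro x' hlev hclose
    have hsep := D.sepT (n - 1) (toBox hN x₁).1 (toBox hN x₁).2 (toBox hN x').1 (toBox hN x').2 (by omega) (by omega)
    have htri := torusSupNorm_sub_le hN1 (toBox hN x₁).1 (toBox hN x).1 (toBox hN x').1
    have := hR n hn hnk
    linarith [hΔ x hx]
  have get : ∀ Y : Site (PV d ℓ m K hd hL) n, Y ∈ (domT hN D hk).Om n →
      ∃ x' : Site (PV d ℓ m K hd hL) 0, iterBlockOf n x' = Y ∧ n ≤ D.lev (toBox hN x').1 := by
    intro Y hY
    obtain ⟨x', hx'⟩ := iterBlock_nonempty (P := PV d ℓ m K hd hL) hnm Y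
    rw [mem_iterBlock] at hx'
    refine ⟨x', hx', ?_⟩
    have := (iterBlockOf_mem_domT_iff hN D hk hnk x').1 (by rw [hx']; exact hY)
    exact this
  constructor
  · intro hY
    obtain ⟨x', hx', hlev⟩ := get _ hY
    exact main x' hlev (torusSupNorm_lt_of_block_shift hN hnm hx')
  · intro hY
    obtain ⟨x', hx', hlev⟩ := get _ hY
    have h' : iterBlockOf n x = (iterBlockOf n x').shift μ := by rw [hx', munshift_shift]
    have hclose := torusSupNorm_lt_of_block_shift hN hnm h'
    rw [show (toBox hN x').1 - (toBox hN x).1 = -((toBox hN x).1 - (toBox hN x').1) by abel, torusSupNorm_neg hN1] at hclose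
    exact main x' hlev hclose

end Far

/-! ## §3  THE MEMBER OF A CUBE: `Λ′(□)` and `w_□` BY CONSTRUCTION; `hΛ` and the weight correspondence PROVED -/

section Construct

open B6SectCTwoScaleV1 (CIdx)

variable (d ℓ hd hL) in
variable {mt Kt j : ℕ} {hj : j + 1 ≤ mt + Kt} {ha : a₀ ≤ a₁}
  {Om : Finset (Site (PV d ℓ m K hd hL) (j + 1))}
  {W : PBond (PV d ℓ m K hd hL) j → ℝ} {W₁ : PBond (PV d ℓ m K hd hL) (j + 1) → ℝ}
  {hW0 : ∀ β, a₀ * ((((ℓ + 1 : ℕ) : ℝ)) ^ j) ^ (d + 1) ≤ W β} {hW1 : ∀ β, W β ≤ a₁ * ((((ℓ + 1 : ℕ) : ℝ)) ^ j) ^ (d + 1)}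
  {hW₁0 : ∀ η, a₀ * ((((ℓ + 1 : ℕ) : ℝ)) ^ j) ^ (d + 1) ≤ W₁ η} {hW₁1 : ∀ η, W₁ η ≤ a₁ * ((((ℓ + 1 : ℕ) : ℝ)) ^ j) ^ (d + 1)}

end Construct

/-! ## §4  `hagree` FOR THE MEMBER OF A CUBE over `domT`: `hΛ` and the weights DISCHARGED BY CONSTRUCTION -/

section Agree

open B6SectAOperatorsV1 (dE dsE dcE dcsE QE aE QsE BondIdx)
open B6Prop26Gluing (mulOp)
open B6Prop26ReachTransplant (transplant chartBond)
open B6Ineq2133TwoScaleV1 (onFun)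

variable {Mh k R : ℕ} {P' : Fin (d + 1) → ℕ}

/-- **THE MEMBER OF A CUBE FOR THE GLOBAL DATA** `(𝔅 = domT, w, c′)`: size `(m_t, K_t)`, scale `j`, window corner `x₀`,
`Λ′(□) = e_{j+1}(Ω_{j+1} ∩ window)`, weights `w_□ = clamp(w ∘ e⁻¹/(c′/L^j)²)` on `Λ^c(□) ⊔ Λ′(□)`. [cite: Balaban1984PropagatorsII, (2.89)–(2.90) p.239] -/
def tOf (hN : ∀ μ, N0 ℓ Mh k P' μ = (PV d ℓ m K hd hL).sitesPerDir 0) (D : TDomains d ℓ Mh k P' R) (hk : k ≤ m + K)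
    (wG : BondIdx (domT hN D hk) → ℝ) (c' : ℝ) (mt Kt j : ℕ) (hj : j + 1 ≤ mt + Kt) (ha : a₀ ≤ a₁) (x₀ : Fin (d + 1) → ℤ) :
    TSIdx d (ℓ + 1) hd hL a₀ a₁ :=
  memberOf mt Kt j hj ha x₀ ((domT hN D hk).Om (j + 1))
    (fun β => clampW a₀ a₁ (((((ℓ + 1 : ℕ) : ℝ)) ^ j) ^ (d + 1)) (wxG (domT hN D hk) wG j β / (c' / (((ℓ + 1 : ℕ) : ℝ) ^ j)) ^ 2))
    (fun η => clampW a₀ a₁ (((((ℓ + 1 : ℕ) : ℝ)) ^ j) ^ (d + 1)) (wxG (domT hN D hk) wG (j + 1) η / (c' / (((ℓ + 1 : ℕ) : ℝ) ^ j)) ^ 2))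
    (fun _ => (clampW_mem ha (by positivity) _).1) (fun _ => (clampW_mem ha (by positivity) _).2)
    (fun _ => (clampW_mem ha (by positivity) _).1) (fun _ => (clampW_mem ha (by positivity) _).2)

/-- the scale of `t(□)`. [cite: Balaban1984PropagatorsII, p.238, dictionary] -/
@[simp] theorem tOf_j (hN : ∀ μ, N0 ℓ Mh k P' μ = (PV d ℓ m K hd hL).sitesPerDir 0) (D : TDomains d ℓ Mh k P' R) (hk : k ≤ m + K)
    (wG : BondIdx (domT hN D hk) → ℝ) (c' : ℝ) (mt Kt j : ℕ) (hj : j + 1 ≤ mt + Kt) (ha : a₀ ≤ a₁) (x₀ : Fin (d + 1) → ℤ) :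
    (tOf hN D hk wG c' mt Kt j hj ha x₀).j = j := rfl

/-- **`hagree` FOR THE MEMBER OF A CUBE, FROM GEOMETRY ONLY**: for `t(□) = tOf …` the ring hypothesis `hagree` of (2.91) —
`M·h_□ = (c′/L^j)²•(ε(Δ_□ + Q*a_□Q)ρ)·h_□`, `M = ∂*∂ + ∂∂* + Q*aQ` over `domT` — holds for every `h_□` supported at margin `4L^{j+1}`, given the
two-level window `hlev`, the separation input `hfar` (see `hfar_of_sepT`) and the weight band of the global weights near `□` (`hband`:
`w/(c′/L^j)² ∈ [a₀, a₁]·(L^j)^{d+1}` on the near `Λ_j`/`Λ_{j+1}` bonds); `Λ′(□)` and `w_□` are discharged BY CONSTRUCTION (`lam_memberOf`,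
`w_memberOf_inl/inr`). [cite: Balaban1984PropagatorsII, (2.89)–(2.91) p.239, (2.2) p.224] -/
theorem hagree_tOf (hN : ∀ μ, N0 ℓ Mh k P' μ = (PV d ℓ m K hd hL).sitesPerDir 0) (D : TDomains d ℓ Mh k P' R) (hk : k ≤ m + K)
    (wG : BondIdx (domT hN D hk) → ℝ) {c' : ℝ} (hc' : c' ≠ 0) (mt Kt j : ℕ) (hj : j + 1 ≤ mt + Kt) (ha : a₀ ≤ a₁)
    (hx₀ : ∀ μ, 0 ≤ x₀ μ) (hfit : ∀ μ, x₀ μ + ((bare d ℓ hd hL mt Kt j hj ha).P.sitesPerDir 0 : ℕ) ≤ ((PV d ℓ m K hd hL).sitesPerDir 0 : ℕ))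
    {r : ℕ} (hjk : j + 1 ≤ k) (hdiv : ∀ μ, ((((ℓ + 1) ^ (j + 1) : ℕ) : ℤ)) ∣ x₀ μ) (hr : 4 * (ℓ + 1) ^ (j + 1) ≤ r)
    (hlev : ∀ x : Site (PV d ℓ m K hd hL) 0, x ∈ DeepS (bare d ℓ hd hL mt Kt j hj ha) x₀ 0 →
      j ≤ D.lev (toBox hN x) ∧ D.lev (toBox hN x) ≤ j + 1)
    (hfar : ∀ n, j + 2 ≤ n → n ≤ k → ∀ x : Site (PV d ℓ m K hd hL) 0, x ∈ DeepS (bare d ℓ hd hL mt Kt j hj ha) x₀ r → ∀ μ,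
      (iterBlockOf n x).shift μ ∉ (domT hN D hk).Om n ∧ (iterBlockOf n x).unshift μ ∉ (domT hN D hk).Om n)
    (hband : ∀ i : BondIdx (domT hN D hk), ((i.1.1 : ℕ) = j ∨ (i.1.1 : ℕ) = j + 1) →
      NearB (bare d ℓ hd hL mt Kt j hj ha) x₀ r i.1.1 i.1.2 →
      a₀ * ((((ℓ + 1 : ℕ) : ℝ)) ^ j) ^ (d + 1) ≤ wG i / (c' / (((ℓ + 1 : ℕ) : ℝ) ^ j)) ^ 2 ∧
        wG i / (c' / (((ℓ + 1 : ℕ) : ℝ) ^ j)) ^ 2 ≤ a₁ * ((((ℓ + 1 : ℕ) : ℝ)) ^ j) ^ (d + 1))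
    (h : PBond (PV d ℓ m K hd hL) 0 → ℝ) (hh : ∀ b, h b ≠ 0 → b ∈ DeepB (bare d ℓ hd hL mt Kt j hj ha) x₀ r) :
    onFun (dcsE (P := PV d ℓ m K hd hL) c' ∘ₗ dcE c' + dE c' ∘ₗ dsE c' +
        QsE (domT hN D hk) ∘ₗ aE (domT hN D hk) wG ∘ₗ QE (domT hN D hk)) * mulOp h =
      (c' / (((ℓ + 1 : ℕ) : ℝ) ^ j)) ^ 2 •
        (transplant (cB (tOf hN D hk wG c' mt Kt j hj ha x₀) x₀ hx₀ hfit).W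
            (chartBond (tOf hN D hk wG c' mt Kt j hj ha x₀) posV PBond.dir x₀)
          (onFun ((tOf hN D hk wG c' mt Kt j hj ha x₀).D.lapV +
            LinearMap.adjoint (tOf hN D hk wG c' mt Kt j hj ha x₀).D.Q ∘ₗ (tOf hN D hk wG c' mt Kt j hj ha x₀).D.a ∘ₗ
              (tOf hN D hk wG c' mt Kt j hj ha x₀).D.Q)) * mulOp h) := by
  have hL1 : (0 : ℝ) < ((ℓ + 1 : ℕ) : ℝ) := by positivity
  have hs : (c' / (((ℓ + 1 : ℕ) : ℝ) ^ j)) ^ 2 ≠ 0 := by positivity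
  have hjm : j + 1 ≤ m + K := by omega
  have hdivj : ∀ μ, ((((ℓ + 1) ^ j : ℕ) : ℤ)) ∣ x₀ μ := fun μ =>
    dvd_trans (by exact_mod_cast pow_dvd_pow (ℓ + 1) (Nat.le_succ j)) (hdiv μ)
  have h2r : 0 + 2 * (ℓ + 1) ^ j ≤ r := by
    have : (ℓ + 1) ^ j ≤ (ℓ + 1) ^ (j + 1) := Nat.pow_le_pow_right (Nat.succ_pos ℓ) (Nat.le_succ j)
    omega
  have h2r1 : 0 + 2 * (ℓ + 1) ^ (j + 1) ≤ r := by omega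
  refine hagree_domT (t := tOf hN D hk wG c' mt Kt j hj ha x₀) hN D hk wG hc' hjk hdiv hr hlev
    (fun Y hY => lam_memberOf hjm hdiv Y hY) hfar ?_ ?_ h hh
  · intro hlt β hβ hβ' hnear
    obtain ⟨b₁, hb₁, hne⟩ := hnear
    have hβw := deep_block_of_near (t := tOf hN D hk wG c' mt Kt j hj ha x₀) (r := 0) (by omega) hx₀ (deepS_mono h2r hb₁) hne
    have hw := w_memberOf_inl (mt := mt) (Kt := Kt) (hj := hj) (ha := ha) (x₀ := x₀) (Om := (domT hN D hk).Om (j + 1))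
      (W := fun β => clampW a₀ a₁ (((((ℓ + 1 : ℕ) : ℝ)) ^ j) ^ (d + 1)) (wxG (domT hN D hk) wG j β / (c' / (((ℓ + 1 : ℕ) : ℝ) ^ j)) ^ 2))
      (W₁ := fun η => clampW a₀ a₁ (((((ℓ + 1 : ℕ) : ℝ)) ^ j) ^ (d + 1)) (wxG (domT hN D hk) wG (j + 1) η / (c' / (((ℓ + 1 : ℕ) : ℝ) ^ j)) ^ 2))
      (hW0 := fun _ => (clampW_mem ha (by positivity) _).1) (hW1 := fun _ => (clampW_mem ha (by positivity) _).2)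
      (hW₁0 := fun _ => (clampW_mem ha (by positivity) _).1) (hW₁1 := fun _ => (clampW_mem ha (by positivity) _).2)
      (by omega) hdivj β hβw hβ'
    change wG ⟨⟨⟨j, hlt⟩, β⟩, hβ⟩ = (c' / (((ℓ + 1 : ℕ) : ℝ) ^ j)) ^ 2 *
      (tOf hN D hk wG c' mt Kt j hj ha x₀).w (Sum.inl ⟨eBj (tOf hN D hk wG c' mt Kt j hj ha x₀) x₀ j β, hβ'⟩)
    have hw' : (tOf hN D hk wG c' mt Kt j hj ha x₀).w (Sum.inl ⟨eBj (tOf hN D hk wG c' mt Kt j hj ha x₀) x₀ j β, hβ'⟩) =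
        clampW a₀ a₁ (((((ℓ + 1 : ℕ) : ℝ)) ^ j) ^ (d + 1)) (wxG (domT hN D hk) wG j β / (c' / (((ℓ + 1 : ℕ) : ℝ) ^ j)) ^ 2) := hw
    rw [hw', wxG_of_lam (domT hN D hk) wG (n := j) hlt hβ]
    obtain ⟨h0, h1⟩ := hband ⟨⟨⟨j, hlt⟩, β⟩, hβ⟩ (Or.inl rfl) ⟨b₁, hb₁, hne⟩
    rw [clampW_of_mem h0 h1, mul_div_cancel₀ _ hs]
  · intro hlt η hη hη' hnear
    obtain ⟨b₁, hb₁, hne⟩ := hnear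
    have hηw := deep_block_of_near (t := tOf hN D hk wG c' mt Kt j hj ha x₀) (r := 0) hjm hx₀ (deepS_mono h2r1 hb₁) hne
    have hw := w_memberOf_inr (mt := mt) (Kt := Kt) (hj := hj) (ha := ha) (x₀ := x₀) (Om := (domT hN D hk).Om (j + 1))
      (W := fun β => clampW a₀ a₁ (((((ℓ + 1 : ℕ) : ℝ)) ^ j) ^ (d + 1)) (wxG (domT hN D hk) wG j β / (c' / (((ℓ + 1 : ℕ) : ℝ) ^ j)) ^ 2))
      (W₁ := fun η => clampW a₀ a₁ (((((ℓ + 1 : ℕ) : ℝ)) ^ j) ^ (d + 1)) (wxG (domT hN D hk) wG (j + 1) η / (c' / (((ℓ + 1 : ℕ) : ℝ) ^ j)) ^ 2))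
      (hW0 := fun _ => (clampW_mem ha (by positivity) _).1) (hW1 := fun _ => (clampW_mem ha (by positivity) _).2)
      (hW₁0 := fun _ => (clampW_mem ha (by positivity) _).1) (hW₁1 := fun _ => (clampW_mem ha (by positivity) _).2)
      hjm hdiv η hηw hη'
    change wG ⟨⟨⟨j + 1, hlt⟩, η⟩, hη⟩ = (c' / (((ℓ + 1 : ℕ) : ℝ) ^ j)) ^ 2 *
      (tOf hN D hk wG c' mt Kt j hj ha x₀).w (Sum.inr ⟨eBj (tOf hN D hk wG c' mt Kt j hj ha x₀) x₀ (j + 1) η, hη'⟩)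
    have hw' : (tOf hN D hk wG c' mt Kt j hj ha x₀).w (Sum.inr ⟨eBj (tOf hN D hk wG c' mt Kt j hj ha x₀) x₀ (j + 1) η, hη'⟩) =
        clampW a₀ a₁ (((((ℓ + 1 : ℕ) : ℝ)) ^ j) ^ (d + 1)) (wxG (domT hN D hk) wG (j + 1) η / (c' / (((ℓ + 1 : ℕ) : ℝ) ^ j)) ^ 2) := hw
    rw [hw', wxG_of_lam (domT hN D hk) wG (n := j + 1) hlt hη]
    obtain ⟨h0, h1⟩ := hband ⟨⟨⟨j + 1, hlt⟩, η⟩, hη⟩ (Or.inr rfl) ⟨b₁, hb₁, hne⟩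
    rw [clampW_of_mem h0 h1, mul_div_cancel₀ _ hs]

end Agree

end Literature.MathematicalPhysics.QuantumFieldTheory.Balaban1983to89.B6MemberOfCubeV1L0
end

-- L0-port marker: J7 call sites rewritten
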